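import Mathlib.MeasureTheory.Function.Jacobian
import Mathlib.Analysis.SpecialFunctions.Trigonometric.DerivHyp
import Mathlib.Analysis.SpecialFunctions.Arsinh

/-!
# Hyperbolic polar coordinates on the right quadrant of `ℝ²`

Auxiliary change of variables for the proof of Lovas–Andai's Lemma 6
(`Literature/Probability/RandomMatrix/LovasAndaiDefectFunction.lean`, fact `LovasAndai2017_lemma6`):
the map `(ℓ, σ) ↦ (ℓ cosh σ, ℓ sinh σ)` is a bijection from `{ℓ > 0} × ℝ` onto the open right
quadrant `{(v, s) : |s| < v}` with Jacobian `ℓ`, whence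
`∫_{|s|<v} g = ∫_{ℓ>0} ∫_σ ℓ · g(ℓ cosh σ, ℓ sinh σ)` for every `g ≥ 0`
(`lintegral_rightQuadrant_eq_hyperbolic`, from Mathlib's
`lintegral_image_eq_lintegral_abs_det_fderiv_mul`). In these coordinates the Lorentz boost
`(v, s) ↦ (v cosh τ + s sinh τ, s cosh τ + v sinh τ)` — which is what Lovas–Andai's similarity
`X ↦ V_ε⁻¹ X V_ε` does to the antisymmetric/symmetric off-diagonal coordinates of `X ∈ ℝ^{2×2}` —
is the shift `σ ↦ σ + τ`; this replaces the atlas of [LovasAndai2017, Appendix A].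

Everything is on the coordinate space `Fin 2 → ℝ` (index `0` = `v` resp. `ℓ`, index `1` = `s`
resp. `σ`), the form in which the slicing argument consumes it.

## References

* [LovasAndai2017] A. Lovas, A. Andai, J. Phys. A 50 (2017) 295303, Appendix A (proof of Lemma 6).
  arXiv:1610.01410.
-/

noncomputable section

open MeasureTheory Set Real
open scoped ENNReal

namespace Literature.Probability.RandomMatrix.LovasAndai

/-- The hyperbolic polar map `(ℓ, σ) ↦ (ℓ cosh σ, ℓ sinh σ)` on `ℝ²` (coordinates `Fin 2 → ℝ`).
[folklore] -/
theorem hyperbolicMap_injOn :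
    InjOn (fun q : Fin 2 → ℝ => (![q 0 * Real.cosh (q 1), q 0 * Real.sinh (q 1)] : Fin 2 → ℝ))
      {q | 0 < q 0} := by
  intro q hq q' hq' h
  simp only [mem_setOf_eq] at hq hq'
  have h0 : q 0 * Real.cosh (q 1) = q' 0 * Real.cosh (q' 1) := by
    have := congrFun h 0; simpa using this
  have h1 : q 0 * Real.sinh (q 1) = q' 0 * Real.sinh (q' 1) := by
    have := congrFun h 1; simpa using this
  -- squares: ℓ² = (ℓ cosh)² − (ℓ sinh)²
  have hsq : q 0 ^ 2 = q' 0 ^ 2 := by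
    have e1 : q 0 ^ 2 = (q 0 * Real.cosh (q 1)) ^ 2 - (q 0 * Real.sinh (q 1)) ^ 2 := by
      have := Real.cosh_sq_sub_sinh_sq (q 1); nlinarith [this]
    have e2 : q' 0 ^ 2 = (q' 0 * Real.cosh (q' 1)) ^ 2 - (q' 0 * Real.sinh (q' 1)) ^ 2 := by
      have := Real.cosh_sq_sub_sinh_sq (q' 1); nlinarith [this]
    rw [e1, e2, h0, h1]
  have hℓ : q 0 = q' 0 := by
    have := (sq_eq_sq₀ hq.le hq'.le).mp hsq
    exact this
  have hσ : q 1 = q' 1 := by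
    rw [hℓ] at h1
    exact Real.sinh_injective (mul_left_cancel₀ hq'.ne' h1)
  funext i
  fin_cases i
  · exact hℓ
  · exact hσ

/-- The image of `{ℓ > 0}` under the hyperbolic polar map is the right quadrant `{|s| < v}`.
[folklore] -/
theorem hyperbolicMap_image :
    (fun q : Fin 2 → ℝ => (![q 0 * Real.cosh (q 1), q 0 * Real.sinh (q 1)] : Fin 2 → ℝ)) ''
        {q | 0 < q 0} = {p : Fin 2 → ℝ | |p 1| < p 0} := by
  ext p
  simp only [mem_image, mem_setOf_eq]
  constructor
  · rintro ⟨q, hq, rfl⟩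
    simp only [Matrix.cons_val_one, Matrix.cons_val_zero]
    rw [abs_mul, abs_of_pos hq]
    have h1 : |Real.sinh (q 1)| < Real.cosh (q 1) := by
      rw [abs_lt]
      constructor
      · have := Real.cosh_pos (q 1)  -- -cosh < sinh
        have h := Real.cosh_sq_sub_sinh_sq (q 1)
        nlinarith [Real.cosh_pos (q 1), sq_nonneg (Real.sinh (q 1) + Real.cosh (q 1))]
      · exact Real.sinh_lt_cosh (q 1)
    exact mul_lt_mul_of_pos_left h1 hq
  · intro hp
    have hv : 0 < p 0 := lt_of_le_of_lt (abs_nonneg _) hp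
    have hℓ2 : 0 < p 0 ^ 2 - p 1 ^ 2 := by
      have : |p 1| ^ 2 < p 0 ^ 2 := by
        exact pow_lt_pow_left₀ hp (abs_nonneg _) two_ne_zero
      rw [sq_abs] at this
      linarith
    set ℓ := Real.sqrt (p 0 ^ 2 - p 1 ^ 2) with hℓ
    have hℓpos : 0 < ℓ := Real.sqrt_pos.mpr hℓ2
    have hℓsq : ℓ ^ 2 = p 0 ^ 2 - p 1 ^ 2 := Real.sq_sqrt hℓ2.le
    refine ⟨![ℓ, Real.arsinh (p 1 / ℓ)], hℓpos, ?_⟩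
    funext i
    fin_cases i
    · simp only [Matrix.cons_val_zero, Matrix.cons_val_one, Fin.zero_eta]
      rw [Real.cosh_arsinh]
      have : 1 + (p 1 / ℓ) ^ 2 = (p 0 / ℓ) ^ 2 := by
        field_simp
        nlinarith [hℓsq]
      rw [this, Real.sqrt_sq (div_nonneg hv.le hℓpos.le)]
      field_simp
    · simp only [Matrix.cons_val_one, Matrix.cons_val_zero, Fin.mk_one]
      rw [Real.sinh_arsinh]
      field_simp

/-- **Hyperbolic polar coordinates** on the right quadrant: for every `g : ℝ² → [0,∞]`,
`∫_{|s|<v} g = ∫_{ℓ>0} ∫_σ ℓ · g(ℓ cosh σ, ℓ sinh σ)` (the Jacobian of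
`(ℓ,σ) ↦ (ℓ cosh σ, ℓ sinh σ)`
is `ℓ (cosh² σ − sinh² σ) = ℓ`). [folklore] -/
theorem lintegral_rightQuadrant_eq_hyperbolic (g : (Fin 2 → ℝ) → ℝ≥0∞) :
    ∫⁻ p in {p : Fin 2 → ℝ | |p 1| < p 0}, g p =
      ∫⁻ q in {q : Fin 2 → ℝ | 0 < q 0},
        ENNReal.ofReal (q 0) * g ![q 0 * Real.cosh (q 1), q 0 * Real.sinh (q 1)] := by
  have hs : MeasurableSet {q : Fin 2 → ℝ | 0 < q 0} :=
    measurableSet_lt measurable_const (measurable_pi_apply 0)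
  -- the derivative of the hyperbolic polar map, as a `ContinuousLinearMap.pi` of its two rows
  let P0 : (Fin 2 → ℝ) →L[ℝ] ℝ := ContinuousLinearMap.proj (R := ℝ) (φ := fun _ : Fin 2 => ℝ) 0
  let P1 : (Fin 2 → ℝ) →L[ℝ] ℝ := ContinuousLinearMap.proj (R := ℝ) (φ := fun _ : Fin 2 => ℝ) 1
  let D : (Fin 2 → ℝ) → Fin 2 → ((Fin 2 → ℝ) →L[ℝ] ℝ) := fun q =>
    ![q 0 • (Real.sinh (q 1) • P1) + Real.cosh (q 1) • P0,
      q 0 • (Real.cosh (q 1) • P1) + Real.sinh (q 1) • P0]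
  have hderiv : ∀ q : Fin 2 → ℝ,
      HasFDerivAt
        (fun q : Fin 2 → ℝ => (![q 0 * Real.cosh (q 1), q 0 * Real.sinh (q 1)] : Fin 2 → ℝ))
        (ContinuousLinearMap.pi (D q)) q := by
    intro q
    have h0 : HasFDerivAt (fun q : Fin 2 → ℝ => q 0) P0 q := P0.hasFDerivAt
    have h1 : HasFDerivAt (fun q : Fin 2 → ℝ => q 1) P1 q := P1.hasFDerivAt
    have hc : HasFDerivAt (fun q : Fin 2 → ℝ => Real.cosh (q 1)) (Real.sinh (q 1) • P1) q := by
      simpa [Function.comp_def] using (Real.hasDerivAt_cosh (q 1)).comp_hasFDerivAt q h1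
    have hsd : HasFDerivAt (fun q : Fin 2 → ℝ => Real.sinh (q 1)) (Real.cosh (q 1) • P1) q := by
      simpa [Function.comp_def] using (Real.hasDerivAt_sinh (q 1)).comp_hasFDerivAt q h1
    rw [hasFDerivAt_pi']
    intro i
    rw [ContinuousLinearMap.proj_pi]
    fin_cases i
    · exact h0.mul hc
    · exact h0.mul hsd
  have hdet : ∀ q : Fin 2 → ℝ, (ContinuousLinearMap.pi (D q)).det = q 0 := by
    intro q
    rw [ContinuousLinearMap.det, ← LinearMap.det_toMatrix', Matrix.det_fin_two]
    simp [LinearMap.toMatrix'_apply, D, P0, P1]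
    have := Real.cosh_sq_sub_sinh_sq (q 1)
    linear_combination q 0 * this
  rw [← hyperbolicMap_image,
    lintegral_image_eq_lintegral_abs_det_fderiv_mul volume hs
      (fun q _ => (hderiv q).hasFDerivWithinAt) hyperbolicMap_injOn]
  refine setLIntegral_congr_fun hs fun q hq => ?_
  have hq' : 0 < q 0 := hq
  rw [hdet q, abs_of_pos hq']

end Literature.Probability.RandomMatrix.LovasAndai

end
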